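import Summits.CriticalPhenomena.PercolationContinuityZ3.Theorems.PercNearOneGluingNoHeavyQuantGateStepNCoreHolds
import Summits.CriticalPhenomena.PercolationContinuityZ3.Theorems.PercNearOneGluingNoHeavyQuantGateMoveRelayStar
import Summits.CriticalPhenomena.PercolationContinuityZ3.Theorems.PercNearOneGluingNoHeavyQuantGatedProductHull
import HarnessLib

/-!
# QUANT lane R8, T-DEC: TWO-RELAY DE-CORRELATION — every sibling with at most two relays is FREE in the gate step
# (`GateStepN` / `GateStepNCore`), for every width, outer gate and floor; unconditionally

builds on p205010 (kernel theorem, internal audit signed; external expert review pending)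

Support file (`--supports stmt-CriticalPhenomena-4575`), QUANT lane lead seat prim-quant-lead (gen 45), rung R8 of
`run/shared/lean/prim/quant/LADDER.md`; memo `run/shared/lean/prim/quant/prim-quant-lead-g45/LEAD-NOTES-G45.md` D1–D4.
Theorems only, standard axioms, no sorries, no definitions.

THE OBSERVATION (law level).  Everything in the gate-elimination architecture (`SDEC`, `DECAt`, the node, its oracle) is a statement
about COUNT LAWS.  A tree-built law with top `2` — the count law of ANY sub-tree carrying two relays (2-chain `R[q](R[s])`, `Y` = gate over
two relays, …; `TreeBuiltN.top_le_two_form`) — is `Y(G; a₁, a₂) := gate_G (relay a₁ ∗ relay a₂) = (1 − m + p, m − 2p, p)`, `m = G(a₁+a₂)`,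
`p = G a₁ a₂`, and is ALWAYS a convex combination of count laws of FREE siblings with the same mean and no marginal below `G·aᵢ`:
if `4p ≤ m²` (real-rooted generating function) `Y = relay g₊ ∗ relay g₋`, `g± = (m ± √(m²−4p))/2`, `G aᵢ ≤ g₋ ≤ g₊ ≤ 1` (`twoRelay_eq_relays`;
e.g. the 2-chain `R[19/20](R[1/2])` of the lane's core instance E\* IS, in law, two INDEPENDENT relays with gates `.8932…`, `.5318…`);
if `m² < 4p` then `Y = λ·blob₂(m/2) + (1−λ)·(relay (m/2))^{∗2}`, `λ = (p − m²/4)/((m/2)(1 − m/2)) ∈ [0,1]` (`twoRelay_eq_mixture`).  Positive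
correlation of the two path events (`p ≥ (G a₁)(G a₂)`) is exactly what places `Y` in this hull.  Hence for an SDEC environment `μ` at
floor `x ≤ G aᵢ`, `μ ∗ Y` is a common-mean mixture of `μ` sliced by two relays (`sdec_slice_relays`, unconditional) and `μ` sliced by one
2-blob (`sdec_slice_blob_of_mixLaw'` fed with the theorem `gatedSliceMixLaw'_holds`), so SDEC (`sdec_of_gatedSDECMixture`):
**`sdec_lconv_twoRelay`**; in the binders of `GateStepN` / `GateStepNCore` every increment `gate c g` with `TreeBuiltN (x/g) n₂ 2 c` is
FREE: **`gateStepN_of_topTwo`**, **`gateStepNCore_of_topTwo`**.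

CONSEQUENCE FOR THE LANE'S MAP (README V393–V420): the 'minimal open family' of the architecture since gen 42 — a gate over three or more
2-CHAINS, incl. the pinned near-tied core E\*, E2–E8 (README V413–V418), the tied family `o[a](R[q](R[s]))³`, arm-1 g46's generic list and
every k-2-chain test-bed — is settled for every width and parameter by peeling the 2-relay siblings one at a time (each peel is
`gateStepN_of_topTwo` with the rest of the forest as environment).  The open population of `GateStepNCore` starts at siblings with THREE
relays whose law is outside the hull of fewer-gate and blob forests (LEAD-NOTES-G45 D3; e.g. the broom `R[7/10](R[9/10], R[9/10])`).
HONEST STATUS: a free sub-case; `GateStepNCore`, `SiblingStep`, `FarTreeRow` OPEN; RATE class log\* / honest sentence unchanged.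
[this work]; slice theorems and the node: this lane (census-2, arm-1, arm-2, typer, lead g42).  Nothing here is cited as a published
result.  The gluing rows served [cite: KozmaNitzan2024, Conjecture 3 (p. 15)]; product measure [cite: Grimmett1999, §1.3 p. 10].
-/

noncomputable section

namespace Summit.CriticalPhenomena.PercolationContinuityZ3.Theorems
namespace Quant
namespace LawDec

open Finset

/-- the sure single relay `δ₁` -/
local notation3 "δ₁" => (fun k : ℕ => if k = 1 then (1 : ℝ) else 0)
/-- the sure pair `δ₂` -/
local notation3 "δ₂" => (fun k : ℕ => if k = 2 then (1 : ℝ) else 0)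

/-! ### Evaluation of the small laws -/

/-- **values of two independent relays**: `relay g₁ ∗ relay g₂ = ((1−g₁)(1−g₂), g₁ + g₂ − 2g₁g₂, g₁g₂, 0, …)`. [this work] -/
theorem relays_apply (g₁ g₂ : ℝ) (h : ℕ) :
    lconv 1 1 (gate δ₁ g₁) (gate δ₁ g₂) h =
      if h = 0 then (1 - g₁) * (1 - g₂) else if h = 1 then (g₁ + g₂) - 2 * (g₁ * g₂) else if h = 2 then g₁ * g₂ else 0 := by
  have eg : ∀ (a : ℝ) (k : ℕ), gate δ₁ a k = if k = 0 then 1 - a else if k = 1 then a else 0 := by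
    intro a k; simp only [gate]; rcases k with _ | _ | k <;> simp
  simp only [lconv, Finset.sum_range_succ, Finset.sum_range_zero, zero_add, eg]
  rcases h with _ | _ | _ | h
  · simp
  · simp; ring
  · simp
  · rw [if_neg (by omega), if_neg (by omega), if_neg (by omega), if_neg (by omega), if_neg (by omega), if_neg (by omega),
      if_neg (by omega)]
    ring

/-- **values of the two-relay law** `Y(G; a₁, a₂) = gate_G (relay a₁ ∗ relay a₂) = (1 − m + p, m − 2p, p, 0, …)`,
`m = G(a₁ + a₂)`, `p = G a₁ a₂`. [this work] -/
theorem twoRelay_apply (G a₁ a₂ : ℝ) (h : ℕ) :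
    gate (lconv 1 1 (gate δ₁ a₁) (gate δ₁ a₂)) G h =
      if h = 0 then 1 - G * (a₁ + a₂) + G * a₁ * a₂
      else if h = 1 then G * (a₁ + a₂) - 2 * (G * a₁ * a₂) else if h = 2 then G * a₁ * a₂ else 0 := by
  simp only [gate, relays_apply]
  rcases h with _ | _ | _ | h
  · simp; ring
  · simp; ring
  · simp; ring
  · simp

/-! ### The two decompositions of the two-relay law -/

/-- **REAL-ROOTED CASE: the two-relay law IS two independent relays.**  With `m = G(a₁+a₂)`, `p = G a₁ a₂`, `4p ≤ m²`, floor
`x ≤ G aᵢ`: there are gates `x ≤ g₋ ≤ g₊ ≤ 1` with `g₊ + g₋ = m`, `g₊ g₋ = p` and `Y(G; a₁, a₂) = relay g₊ ∗ relay g₋`. [this work] -/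
theorem twoRelay_eq_relays (x G a₁ a₂ : ℝ) (hx0 : 0 < x) (hG0 : 0 < G) (hG1 : G ≤ 1) (ha₁ : a₁ ≤ 1) (ha₂ : a₂ ≤ 1)
    (hx₁ : x ≤ G * a₁) (hx₂ : x ≤ G * a₂) (hD : 4 * (G * a₁ * a₂) ≤ (G * (a₁ + a₂)) ^ 2) :
    ∃ gp gm : ℝ, x ≤ gm ∧ gm ≤ gp ∧ gp ≤ 1 ∧ gp + gm = G * (a₁ + a₂) ∧ gp * gm = G * a₁ * a₂ ∧
      gate (lconv 1 1 (gate δ₁ a₁) (gate δ₁ a₂)) G = lconv 1 1 (gate δ₁ gp) (gate δ₁ gm) := by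
  set m : ℝ := G * (a₁ + a₂) with hm
  set p : ℝ := G * a₁ * a₂ with hp
  have ha₁0 : 0 < a₁ := by by_contra h0; rw [not_lt] at h0; nlinarith
  have ha₂0 : 0 < a₂ := by by_contra h0; rw [not_lt] at h0; nlinarith
  have hD0 : 0 ≤ m ^ 2 - 4 * p := by rw [hm, hp]; linarith
  set r : ℝ := Real.sqrt (m ^ 2 - 4 * p) with hr
  have hr0 : 0 ≤ r := Real.sqrt_nonneg _
  have hrr : r * r = m ^ 2 - 4 * p := Real.mul_self_sqrt hD0
  -- `r ≤ 2 − m` from `m − 1 ≤ p` (the mass at `0` is nonnegative)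
  have hm2 : m ≤ 2 := by rw [hm]; nlinarith
  have hp1 : m - 1 ≤ p := by
    rw [hm, hp]; nlinarith [mul_nonneg (sub_nonneg.2 hG1) (sub_nonneg.2 ha₁), mul_nonneg (sub_nonneg.2 ha₁) (sub_nonneg.2 ha₂),
      mul_nonneg (mul_nonneg hG0.le (sub_nonneg.2 ha₁)) (sub_nonneg.2 ha₂)]
  have hr2 : r ≤ 2 - m := by
    have e : Real.sqrt ((2 - m) ^ 2) = 2 - m := Real.sqrt_sq (by linarith)
    rw [hr, ← e]
    exact Real.sqrt_le_sqrt (by nlinarith)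
  -- `x(m − x) ≤ p` (monotonicity of `z(m−z)` below `m/2`, and `G² a₁ a₂ ≤ G a₁ a₂`)
  have hxp : x * (m - x) ≤ p := by
    rw [hm, hp]
    nlinarith [mul_nonneg (sub_nonneg.2 hx₁) (sub_nonneg.2 hx₂), mul_nonneg (mul_nonneg hG0.le ha₁0.le) ha₂0.le,
      mul_nonneg (mul_nonneg (mul_nonneg hG0.le ha₁0.le) ha₂0.le) (sub_nonneg.2 hG1)]
  refine ⟨(m + r) / 2, (m - r) / 2, ?_, by linarith, by linarith, by ring, ?_, ?_⟩
  · -- `x ≤ g₋`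
    by_contra hlt
    rw [not_le] at hlt
    have h1 : (m - r) / 2 - x < 0 := by linarith
    have h2x : 2 * x ≤ m := by rw [hm]; linarith
    have h2 : 0 < m - x - (m - r) / 2 := by nlinarith
    have key : ((m - r) / 2 - x) * (m - x - (m - r) / 2) = p - x * (m - x) := by nlinarith
    nlinarith [mul_neg_of_neg_of_pos h1 h2]
  · nlinarith
  · funext h
    rw [twoRelay_apply, relays_apply]
    rcases h with _ | _ | _ | h
    · simp; nlinarith
    · simp; nlinarith
    · simp; nlinarith
    · simp

/-- **MIXTURE CASE: the two-relay law is a mixture of a 2-blob and two equal independent relays**, all at gate `m/2`: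
with `m² ≤ 4p` (so `m < 2`), `λ = (p − (m/2)²)/((m/2)(1 − m/2)) ∈ [0,1]` and
`Y(G; a₁, a₂) = λ·gate_{m/2} δ₂ + (1−λ)·(relay (m/2) ∗ relay (m/2))`. [this work] -/
theorem twoRelay_eq_mixture (x G a₁ a₂ : ℝ) (hx0 : 0 < x) (hG0 : 0 < G) (hG1 : G ≤ 1) (ha₁ : a₁ ≤ 1) (ha₂ : a₂ ≤ 1)
    (hx₁ : x ≤ G * a₁) (hx₂ : x ≤ G * a₂) (hD : (G * (a₁ + a₂)) ^ 2 < 4 * (G * a₁ * a₂)) :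
    ∃ lam g : ℝ, 0 ≤ lam ∧ lam ≤ 1 ∧ x ≤ g ∧ g < 1 ∧ 2 * g = G * (a₁ + a₂) ∧
      gate (lconv 1 1 (gate δ₁ a₁) (gate δ₁ a₂)) G =
        fun h => lam * gate δ₂ g h + (1 - lam) * lconv 1 1 (gate δ₁ g) (gate δ₁ g) h := by
  have ha₁0 : 0 < a₁ := by by_contra h0; rw [not_lt] at h0; nlinarith
  have ha₂0 : 0 < a₂ := by by_contra h0; rw [not_lt] at h0; nlinarith
  have hp1 : G * a₁ * a₂ ≤ 1 := by
    calc G * a₁ * a₂ ≤ 1 * 1 * 1 := by gcongr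
      _ = 1 := by ring
  -- the common gate `g = m/2`
  obtain ⟨g, hg⟩ : ∃ g : ℝ, 2 * g = G * (a₁ + a₂) := ⟨G * (a₁ + a₂) / 2, by ring⟩
  have hpg : G * a₁ * a₂ ≤ g := by nlinarith
  have hg1 : g < 1 := by
    by_contra hle
    rw [not_lt] at hle
    have hgle : g ≤ 1 := by nlinarith
    have hg1' : g = 1 := le_antisymm hgle hle
    rw [hg1'] at hg
    nlinarith
  have hxg : x ≤ g := by nlinarith
  have hg0 : 0 < g := lt_of_lt_of_le hx0 hxg
  have hden : 0 < g * (1 - g) := mul_pos hg0 (by linarith)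
  -- the weight
  obtain ⟨lam, hlam⟩ : ∃ lam : ℝ, lam * (g * (1 - g)) = G * a₁ * a₂ - g ^ 2 :=
    ⟨(G * a₁ * a₂ - g ^ 2) / (g * (1 - g)), div_mul_cancel₀ _ (ne_of_gt hden)⟩
  have hnum : 0 ≤ G * a₁ * a₂ - g ^ 2 := by nlinarith
  have hl0 : 0 ≤ lam := by
    by_contra h0; rw [not_le] at h0; nlinarith [mul_neg_of_neg_of_pos h0 hden]
  have hl1 : lam ≤ 1 := by
    by_contra h1; rw [not_le] at h1
    have : g * (1 - g) < lam * (g * (1 - g)) := by nlinarith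
    nlinarith
  refine ⟨lam, g, hl0, hl1, hxg, hg1, hg, ?_⟩
  funext h
  rw [twoRelay_apply, relays_apply]
  simp only [gate]
  rcases h with _ | _ | _ | h
  · simp
    linear_combination hg - hlam
  · simp
    linear_combination (-1 : ℝ) * hg + 2 * hlam
  · simp
    linear_combination (-1 : ℝ) * hlam
  · simp

/-! ### SDEC of an environment sliced by a two-relay sibling -/

/-- **TWO-RELAY DE-CORRELATION (SDEC form).**  For a floor `0 < x < 1`, a probability law `μ` on `{0..M}` that is top-affordable
and SDEC at `x`, and a two-relay law `Y(G; a₁, a₂)` (`G ≤ 1`, `aᵢ ≤ 1`) whose two marginals are `≥ x`: `μ ∗ Y` is SDEC at `x`.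
Proof: the two decompositions above; relay slices (`sdec_slice_relays`), the 2-blob slice (`sdec_slice_blob_of_mixLaw'` +
`gatedSliceMixLaw'_holds`), and convexity of SDEC at a common mean (`sdec_of_gatedSDECMixture`). [this work] -/
theorem sdec_lconv_twoRelay (x G a₁ a₂ : ℝ) (M : ℕ) (μ : ℕ → ℝ) (hx0 : 0 < x) (hx1 : x < 1)
    (hG0 : 0 < G) (hG1 : G ≤ 1) (ha₁ : a₁ ≤ 1) (ha₂ : a₂ ≤ 1) (hx₁ : x ≤ G * a₁) (hx₂ : x ≤ G * a₂)
    (hμ0 : ∀ h, 0 ≤ μ h) (hμM : ∀ h, M < h → μ h = 0) (hμ1 : ∑ h ∈ Finset.range (M + 1), μ h = 1)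
    (hta : x * (M : ℝ) ≤ ∑ h ∈ Finset.range (M + 1), (h : ℝ) * μ h) (hS : SDEC x M μ) :
    SDEC x (M + 2) (lconv M 2 μ (gate (lconv 1 1 (gate δ₁ a₁) (gate δ₁ a₂)) G)) := by
  have hSu : SDECUpTo x 1 M μ := by rwa [sdecUpTo_one_iff]
  have ha₁0 : 0 < a₁ := by by_contra h0; rw [not_lt] at h0; nlinarith
  have ha₂0 : 0 < a₂ := by by_contra h0; rw [not_lt] at h0; nlinarith
  rcases le_or_gt (4 * (G * a₁ * a₂)) ((G * (a₁ + a₂)) ^ 2) with hD | hD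
  · -- real-rooted: two relay slices
    obtain ⟨gp, gm, hxm, hmp, hp1, _, _, hY⟩ := twoRelay_eq_relays x G a₁ a₂ hx0 hG0 hG1 ha₁ ha₂ hx₁ hx₂ hD
    have hgs : ∀ g ∈ [gm, gp], x ≤ g ∧ g ≤ 1 := by
      intro g hg
      simp only [List.mem_cons, List.mem_nil_iff, or_false] at hg
      rcases hg with rfl | rfl
      exacts [⟨hxm, hmp.trans hp1⟩, ⟨hxm.trans hmp, hp1⟩]
    obtain ⟨_, _, _, _, hsd⟩ := sdecUpTo_slice_relays x 1 hx0 le_rfl (by rwa [one_mul]) [gm, gp] hgs M μ hμ0 hμM hμ1 hta hSu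
    simp only [List.foldr_cons, List.foldr_nil, List.length_cons, List.length_nil] at hsd
    have e : lconv M 2 μ (gate (lconv 1 1 (gate δ₁ a₁) (gate δ₁ a₂)) G) = slice (slice μ 1 gp) 1 gm := by
      rw [hY, show (2 : ℕ) = 1 + 1 from rfl, lconv_assoc, lconv_gate_point_eq_slice M 1 μ gp hμM,
        lconv_gate_point_eq_slice (M + 1) 1 _ gm (fun h hh => slice_eq_zero μ 1 gp M hμM h hh)]
    rw [e, ← sdecUpTo_one_iff]; exact hsd
  · -- mixture: a 2-blob slice and two equal relay slices at a common mean
    obtain ⟨lam, g, hl0, hl1, hxg, hg1, h2g, hY⟩ := twoRelay_eq_mixture x G a₁ a₂ hx0 hG0 hG1 ha₁ ha₂ hx₁ hx₂ hD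
    -- piece `true`: the 2-blob slice; piece `false`: two relay slices
    have hB := sdec_slice_blob_of_mixLaw' gatedSliceMixLaw'_holds x g M 2 μ hx0 hx1 hxg hg1.le (by norm_num) hμ0 hμM hμ1 hta hS
    have hgs : ∀ g' ∈ [g, g], x ≤ g' ∧ g' ≤ 1 := by
      intro g' hg'
      simp only [List.mem_cons, List.mem_nil_iff, or_false] at hg'
      rcases hg' with rfl | rfl <;> exact ⟨hxg, hg1.le⟩
    obtain ⟨hR0, hRM, hR1, hRta, hRsd⟩ := sdecUpTo_slice_relays x 1 hx0 le_rfl (by rwa [one_mul]) [g, g] hgs M μ hμ0 hμM hμ1 hta hSu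
    simp only [List.foldr_cons, List.foldr_nil, List.length_cons, List.length_nil] at hR0 hRM hR1 hRta hRsd
    rw [sdecUpTo_one_iff] at hRsd
    -- the target law as a two-piece mixture
    set P : Bool → ℕ → ℝ := fun b => if b then slice μ 2 g else slice (slice μ 1 g) 1 g with hP
    set w : Bool → ℝ := fun b => if b then lam else 1 - lam with hw
    have eB : lconv M 2 μ (gate δ₂ g) = slice μ 2 g := lconv_gate_point_eq_slice M 2 μ g hμM
    have eS : lconv M 2 μ (lconv 1 1 (gate δ₁ g) (gate δ₁ g)) = slice (slice μ 1 g) 1 g := by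
      rw [show (2 : ℕ) = 1 + 1 from rfl, lconv_assoc, lconv_gate_point_eq_slice M 1 μ g hμM,
        lconv_gate_point_eq_slice (M + 1) 1 _ g (fun h hh => slice_eq_zero μ 1 g M hμM h hh)]
    have hmix : ∀ h, lconv M 2 μ (gate (lconv 1 1 (gate δ₁ a₁) (gate δ₁ a₂)) G) h = ∑ b, w b * gate (P b) 1 h := by
      intro h
      have eY : (fun k => lam * gate δ₂ g k + (1 - lam) * lconv 1 1 (gate δ₁ g) (gate δ₁ g) k)
          = fun k => ∑ b : Bool, w b * (fun b' : Bool => if b' then gate δ₂ g else lconv 1 1 (gate δ₁ g) (gate δ₁ g)) b k := by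
        funext k
        simp only [Fintype.sum_bool, hw]
        simp
      rw [hY, eY, lconv_sum_right]
      simp only [Fintype.sum_bool, hw, hP, gate_one]
      simp [eB, eS]
    -- means
    have hmeanμ := sum_mul_slice μ 2 g M hμM hμ1
    have hmeanR : ∑ h ∈ Finset.range (M + 1 + 1 + 1), (h : ℝ) * slice (slice μ 1 g) 1 g h
        = ∑ h ∈ Finset.range (M + 1), (h : ℝ) * μ h + 2 * g := by
      rw [sum_mul_slice (slice μ 1 g) 1 g (M + 1) (fun h hh => slice_eq_zero μ 1 g M hμM h hh)
        (sum_slice μ 1 g M hμM hμ1), sum_mul_slice μ 1 g M hμM hμ1]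
      push_cast; ring
    -- mean of the target
    have hY0 : ∀ h, 0 ≤ gate (lconv 1 1 (gate δ₁ a₁) (gate δ₁ a₂)) G h := by
      intro h
      rw [twoRelay_apply]
      rcases h with _ | _ | _ | h
      · simp
        nlinarith [mul_nonneg (sub_nonneg.2 hG1) (sub_nonneg.2 ha₁), mul_nonneg (sub_nonneg.2 ha₁) (sub_nonneg.2 ha₂),
          mul_nonneg (mul_nonneg hG0.le (sub_nonneg.2 ha₁)) (sub_nonneg.2 ha₂)]
      · simp
        nlinarith [mul_nonneg (mul_nonneg hG0.le ha₁0.le) (sub_nonneg.2 ha₂),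
          mul_nonneg (mul_nonneg hG0.le ha₂0.le) (sub_nonneg.2 ha₁)]
      · simp; exact mul_nonneg (mul_nonneg hG0.le ha₁0.le) ha₂0.le
      · simp
    have v0 : gate (lconv 1 1 (gate δ₁ a₁) (gate δ₁ a₂)) G 0 = 1 - G * (a₁ + a₂) + G * a₁ * a₂ := by
      rw [twoRelay_apply, if_pos rfl]
    have v1 : gate (lconv 1 1 (gate δ₁ a₁) (gate δ₁ a₂)) G 1 = G * (a₁ + a₂) - 2 * (G * a₁ * a₂) := by
      rw [twoRelay_apply, if_neg one_ne_zero, if_pos rfl]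
    have v2 : gate (lconv 1 1 (gate δ₁ a₁) (gate δ₁ a₂)) G 2 = G * a₁ * a₂ := by
      rw [twoRelay_apply, if_neg (by norm_num), if_neg (by norm_num), if_pos rfl]
    have hYsum : ∑ h ∈ Finset.range (2 + 1), gate (lconv 1 1 (gate δ₁ a₁) (gate δ₁ a₂)) G h = 1 := by
      rw [Finset.sum_range_succ, Finset.sum_range_succ, Finset.sum_range_succ, Finset.sum_range_zero, v0, v1, v2]
      ring
    have hYmean : ∑ h ∈ Finset.range (2 + 1), (h : ℝ) * gate (lconv 1 1 (gate δ₁ a₁) (gate δ₁ a₂)) G h = 2 * g := by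
      rw [Finset.sum_range_succ, Finset.sum_range_succ, Finset.sum_range_succ, Finset.sum_range_zero, v0, v1, v2]
      push_cast
      linear_combination (-1 : ℝ) * h2g
    have hmeanT : ∑ h ∈ Finset.range (M + 2 + 1), (h : ℝ) * lconv M 2 μ (gate (lconv 1 1 (gate δ₁ a₁) (gate δ₁ a₂)) G) h
        = ∑ h ∈ Finset.range (M + 1), (h : ℝ) * μ h + 2 * g := by
      rw [sum_mul_lconv M 2 μ _ hμ1 hYsum, hYmean]
    refine sdec_of_gatedSDECMixture x (M + 2) _ w (fun _ => 1) (fun _ => M + 2) P hx0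
      (fun b => ?_) (by simp [hw]) (fun _ => ⟨hx1, le_rfl⟩)
      (fun b h => ?_) (fun b h hh => ?_) (fun b => ?_) (fun b => ?_) (fun b => ?_) (fun _ => le_rfl) (fun b => ?_) hmix
    · cases b <;> simp [hw] <;> linarith
    · cases b
      · simpa [hP] using hR0 h
      · simpa [hP] using slice_nonneg μ 2 g (le_trans hx0.le hxg) hg1.le hμ0 h
    · cases b
      · simpa [hP] using hRM h (by simpa using hh)
      · simpa [hP] using slice_eq_zero μ 2 g M hμM h (by simpa using hh)
    · cases b
      · simpa [hP] using hR1
      · simpa [hP] using sum_slice μ 2 g M hμM hμ1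
    · cases b
      · simp only [hP, div_one, Bool.false_eq_true, if_false]
        rw [hmeanR]; push_cast; nlinarith
      · simp only [hP, div_one, if_true]
        rw [hmeanμ]; push_cast; nlinarith
    · cases b
      · simpa [hP, div_one] using hRsd
      · simpa [hP, div_one] using hB
    · cases b
      · simp only [hP, Bool.false_eq_true, if_false, one_mul]
        rw [hmeanR, hmeanT]
      · simp only [hP, if_true, one_mul]
        rw [hmeanμ, hmeanT]; push_cast; ring

/-! ### Tree-built laws with at most two relays, and the node-level corollaries -/

/-- **shape of a tree-built law with top `≤ 2`**: top `0` is `δ₀`; top `1` is a relay `gate δ₁ a` with `x ≤ a ≤ 1`; top `2` is a two-relay law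
`Y(G; a₁, a₂) = gate_G (relay a₁ ∗ relay a₂)` with `0 < G ≤ 1`, `aᵢ ≤ 1` and both marginals `G·aᵢ ≥ x` (induction on the derivation: gates
compose multiplicatively, floor-lowering only weakens the marginal bounds). [this work] -/
theorem TreeBuiltN.top_le_two_form {x : ℝ} {n M : ℕ} {μ : ℕ → ℝ} (h : TreeBuiltN x n M μ) :
    (M = 0 → μ = fun k => if k = 0 then (1 : ℝ) else 0) ∧
    (M = 1 → ∃ a : ℝ, x ≤ a ∧ a ≤ 1 ∧ μ = LawDec.gate δ₁ a) ∧
    (M = 2 → ∃ G a₁ a₂ : ℝ, 0 < G ∧ G ≤ 1 ∧ a₁ ≤ 1 ∧ a₂ ≤ 1 ∧ x ≤ G * a₁ ∧ x ≤ G * a₂ ∧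
        μ = LawDec.gate (lconv 1 1 (LawDec.gate δ₁ a₁) (LawDec.gate δ₁ a₂)) G) := by
  induction h with
  | nil x₀ hx0 hx1 =>
    exact ⟨fun _ => rfl, fun h => absurd h (by norm_num), fun h => absurd h (by norm_num)⟩
  | relay x₀ hx0 hx1 =>
    refine ⟨fun h => absurd h (by norm_num), fun _ => ⟨1, hx1.le, le_rfl, ?_⟩, fun h => absurd h (by norm_num)⟩
    rw [gate_one]
  | @conv x₀ na nb Ma Mb a b ha hb iha ihb =>
    obtain ⟨_, _, _, haM, _, _⟩ := ha.lawFacts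
    obtain ⟨hx₀0, _, _, hbM, _, _⟩ := hb.lawFacts
    obtain ⟨h0a, h1a, h2a⟩ := iha
    obtain ⟨h0b, h1b, h2b⟩ := ihb
    refine ⟨fun hM => ?_, fun hM => ?_, fun hM => ?_⟩
    · obtain ⟨hMa, hMb⟩ : Ma = 0 ∧ Mb = 0 := ⟨by omega, by omega⟩
      subst hMa; subst hMb
      funext k; rw [h0b rfl, lconv_delta_right 0 0 a haM k, h0a rfl]
    · rcases Nat.eq_zero_or_pos Ma with hMa | hMa
      · have hMb : Mb = 1 := by omega
        subst hMa; subst hMb; obtain ⟨β, hxβ, hβ1, hbe⟩ := h1b rfl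
        exact ⟨β, hxβ, hβ1, by funext k; rw [h0a rfl, lconv_delta_left 0 1 b hbM k, hbe]⟩
      · have hMa1 : Ma = 1 := by omega
        have hMb : Mb = 0 := by omega
        subst hMa1; subst hMb
        obtain ⟨α, hxα, hα1, hae⟩ := h1a rfl
        exact ⟨α, hxα, hα1, by funext k; rw [h0b rfl, lconv_delta_right 1 0 a haM k, hae]⟩
    · rcases Nat.eq_zero_or_pos Ma with hMa | hMa
      · have hMb : Mb = 2 := by omega
        subst hMa; subst hMb
        obtain ⟨G, a₁, a₂, hG0, hG1, ha₁, ha₂, hx₁, hx₂, hbe⟩ := h2b rfl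
        exact ⟨G, a₁, a₂, hG0, hG1, ha₁, ha₂, hx₁, hx₂, by funext k; rw [h0a rfl, lconv_delta_left 0 2 b hbM k, hbe]⟩
      · rcases Nat.eq_zero_or_pos Mb with hMb | hMb
        · have hMa2 : Ma = 2 := by omega
          subst hMa2; subst hMb
          obtain ⟨G, a₁, a₂, hG0, hG1, ha₁, ha₂, hx₁, hx₂, hae⟩ := h2a rfl
          exact ⟨G, a₁, a₂, hG0, hG1, ha₁, ha₂, hx₁, hx₂, by funext k; rw [h0b rfl, lconv_delta_right 2 0 a haM k, hae]⟩
        · have hMa1 : Ma = 1 := by omega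
          have hMb1 : Mb = 1 := by omega
          subst hMa1; subst hMb1
          obtain ⟨α, hxα, hα1, hae⟩ := h1a rfl
          obtain ⟨β, hxβ, hβ1, hbe⟩ := h1b rfl
          refine ⟨1, α, β, one_pos, le_rfl, hα1, hβ1, by linarith, by linarith, ?_⟩
          rw [hae, hbe, gate_one]
  | @gate x₀ n₀ M₀ ρ q hq0 hq1 hρ ih =>
    obtain ⟨hx₀0, _, _, _, _, _⟩ := hρ.lawFacts
    obtain ⟨h0, h1, h2⟩ := ih
    refine ⟨fun hM => ?_, fun hM => ?_, fun hM => ?_⟩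
    · funext k; rw [h0 hM]; simp only [LawDec.gate]; split_ifs <;> ring
    · obtain ⟨a, hxa, ha1, hρe⟩ := h1 hM
      refine ⟨q * a, mul_le_mul_of_nonneg_left hxa hq0.le, by nlinarith, ?_⟩
      rw [hρe, gate_gate]
    · obtain ⟨G, a₁, a₂, hG0, hG1, ha₁, ha₂, hx₁, hx₂, hρe⟩ := h2 hM
      refine ⟨q * G, a₁, a₂, mul_pos hq0 hG0, by nlinarith, ha₁, ha₂, ?_, ?_, ?_⟩
      · rw [mul_assoc]; exact mul_le_mul_of_nonneg_left hx₁ hq0.le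
      · rw [mul_assoc]; exact mul_le_mul_of_nonneg_left hx₂ hq0.le
      · rw [hρe, gate_gate]
  | @mono x₀ x'' n₀ M₀ μ₀ h hx''0 hxx ih =>
    obtain ⟨h0, h1, h2⟩ := ih
    refine ⟨h0, fun hM => ?_, fun hM => ?_⟩
    · obtain ⟨a, hxa, ha1, he⟩ := h1 hM; exact ⟨a, hxx.trans hxa, ha1, he⟩
    · obtain ⟨G, a₁, a₂, hG0, hG1, ha₁, ha₂, hx₁, hx₂, he⟩ := h2 hM
      exact ⟨G, a₁, a₂, hG0, hG1, ha₁, ha₂, hxx.trans hx₁, hxx.trans hx₂, he⟩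

/-- **EVERY TWO-RELAY INCREMENT IS FREE inside `GateStepN`.**  In the node's binder (budget `n`, the oracle, environment `μ₁`
tree-built with `n₁` gates, increment `gate c g` with `c` tree-built at floor `x/g`) with `M₂ = 2` — the new sibling carries exactly two
relays, in ANY shape — the forest `μ₁ ∗ gate_g c` is SDEC at `x`.  (`M₂ = 0, 1`: `gateStepN_of_point` / `gateStepN_of_relay`.) [this work] -/
theorem gateStepN_of_topTwo (n : ℕ) (x g : ℝ) (n₁ n₂ M₁ : ℕ) (μ₁ c : ℕ → ℝ)
    (hO : ∀ (x' : ℝ) (n' M' : ℕ) (μ' : ℕ → ℝ), n' < n → TreeBuiltN x' n' M' μ' → SDEC x' M' μ')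
    (hn : n₁ + n₂ + 1 ≤ n) (hx0 : 0 < x) (hxg : x < g) (hg1 : g < 1)
    (h₁ : TreeBuiltN x n₁ M₁ μ₁) (hc : TreeBuiltN (x / g) n₂ 2 c) :
    SDEC x (M₁ + 2) (lconv M₁ 2 μ₁ (gate c g)) := by
  obtain ⟨_, hx1, n1, z1, s1, t1⟩ := h₁.lawFacts
  have hS1 : SDEC x M₁ μ₁ := hO x n₁ M₁ μ₁ (by omega) h₁
  obtain ⟨G, a₁, a₂, hG0, hG1, ha₁, ha₂, hx₁, hx₂, hc'⟩ := hc.top_le_two_form.2.2 rfl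
  have hg0 : 0 < g := lt_trans hx0 hxg
  have hx₁' : x ≤ G * a₁ * g := (div_le_iff₀ hg0).1 hx₁
  have hx₂' : x ≤ G * a₂ * g := (div_le_iff₀ hg0).1 hx₂
  rw [hc', gate_gate]
  refine sdec_lconv_twoRelay x (g * G) a₁ a₂ M₁ μ₁ hx0 hx1 (mul_pos hg0 hG0) (by nlinarith) ha₁ ha₂
    (by nlinarith) (by nlinarith) n1 z1 s1 t1 hS1

/-- **… and inside `GateStepNCore`** (environment a genuine convolution `a ∗ b`; the 'not a point mass' proviso is not needed). [this work] -/
theorem gateStepNCore_of_topTwo (n : ℕ) (x g : ℝ) (na nb n₂ Ma Mb : ℕ) (a b c : ℕ → ℝ)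
    (hO : ∀ (x' : ℝ) (n' M' : ℕ) (μ' : ℕ → ℝ), n' < n → TreeBuiltN x' n' M' μ' → SDEC x' M' μ')
    (hn : na + nb + n₂ + 1 ≤ n) (hx0 : 0 < x) (hxg : x < g) (hg1 : g < 1)
    (ha : TreeBuiltN x na Ma a) (hb : TreeBuiltN x nb Mb b) (hc : TreeBuiltN (x / g) n₂ 2 c) :
    SDEC x (Ma + Mb + 2) (lconv (Ma + Mb) 2 (lconv Ma Mb a b) (gate c g)) :=
  gateStepN_of_topTwo n x g (na + nb) n₂ (Ma + Mb) (lconv Ma Mb a b) c hO (by omega) hx0 hxg hg1 (TreeBuiltN.conv ha hb) hc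

end LawDec
end Quant
end Summit.CriticalPhenomena.PercolationContinuityZ3.Theorems
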